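import Summits.AtomisticToContinuum.HydrodynamicLimit.Theorems.InformationPercolationEngineKickFairRelEquilibriumMesoLongWindowDefs
import Summits.AtomisticToContinuum.HydrodynamicLimit.Theorems.InformationPercolationEngineKickFairRelEquilibriumMesoLongWindowGlue
import Summits.AtomisticToContinuum.HydrodynamicLimit.Theorems.InformationPercolationEngineKickFairRelEquilibriumMesoClosePairCountLong
import Summits.AtomisticToContinuum.HydrodynamicLimit.Theorems.KickFairRelEquilibriumMeso.Negative.WindowAlgebra
import HarnessLib

/-!
# Line `kinetic-window-cut` for the crux `KickFairRelEquilibriumMeso`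
# (stmt-AtomisticToContinuum-15177, route `InformationPercolationEngine`, rank 2) — checked skeleton, rev 5b: the LONG-FLIGHT window cut
# (lead c8, 2026-08-17; revs 1–3: strategist s1 / lead c7; rev 5 registered 13:40Z, rev 5b = CPL and the glue LANDED and wired)

The crux: `∃ rs` admissible such that under the LOCAL Gibbs law `LG` the past-weighted, EQUILIBRIUM-centred kick sum
`S_h = (ε/(N+1)) Σ_i Σ_{n<cnt_i} h_{i,n}(P_{i,n}) (g(X_{i,n}) − κ_{i,n})` has `E_LG |S_h| ≤ δ` eventually, uniformly over
measurable `|h| ≤ 1` (`MesoBody rs` + window conjuncts, `kickFairRelEquilibriumMeso_iff`, p109023).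

## Rev 5 — what changed and why (lead c8)

Rev 3 (c7) = {B1, SW, CT-a, CP} with the window reduction WR landed (p158078/p158389). Wave 4 of c7 located the remaining EQUILIBRIUM wall of
rev 3 precisely: both CP (off-diagonal part) and SW (count input (I)) need a SECOND-moment (pair-Campbell) bound for window collision counts under
the invariant law (`WindowCountSqMomentConst` = CollisionRate's `PM|const`, documented unproved; the tree's collision engines are first-moment by
design). The lead judges that input research-level (no uniform-in-`N` second factorial moment of tagged-sphere window collision counts at fixed
reduced density in print; pathwise routes die on Burago–Ferleger–Kononenko collision multiplicities, probabilistic ones are short-time Lanford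
expansions for Palm data) and removes it INSIDE the line, keeping the composition idea (kinetic windows, no cross-window pair, pull-out on the join,
close pairs counted, far pairs charged `|Γ|`):

* import the landed SHORT-FLIGHT CUT of the dead line `Sketch`: `h = h·1_L + h·1_S` by the length of the flight of sphere `i` ending in the kick
  (`IsLong A t_N p : t_N/A ≤ t − s_i`, read off the typed past). The short part costs `4C · E_LG[(ε/(N+1)) #short]` → stub U (`ShortFlightLG`, the
  Sketch line's registered statement, PROVED at constant profiles `shortFlightLG_rung0` p126384, implies CT-a p148642). On the long part each sphere
  has AT MOST `A+1` kicks per kinetic window PATHWISE (`stub_cutCount` p121309): the same-window pair count is deterministically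
  `≤ W(A+1)²(N+1)²`, so SW needs NO count input, and the long kick sum is pathwise bounded, so the index truncation disappears (Fatou in the level) and
  with it CT-a;
* read closeness at a COMMON GRID TIME through the two typed pasts (`predPt` = first-photo cell centre of `i` moved by its free flight, within `r`
  of the true collision point; `anchorPt` = first-photo cell centre of `i'` moved to the grid time `u(t') = m(⌈t'/m⌉ − 1) ∈ (s_{i'}, t')`,
  `m = t_N/(2A)`, within `r` of the true position of `i'` at `u(t')`): CLOSE = same window ∧ (points within `5r` ∨ `i'` fast, `‖v_{i'}‖ > rA/t_N`),
  FAR = same window ∧ neither (collision points `≥ 2r` apart). Then CP becomes CPL, a DETERMINISTIC packing count (injection of long kicks into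
  (sphere, grid index); `≤ 2A+2` grid indices per window; at a grid time at most `((14r+ε)/ε)³` sphere centres within `7r` of a point; fast spheres
  `≤ KE/V²`) of size `O((A+1)² (τ+1) rs³/σ) + O(K σ² (N+1)^{-1/6})` on `{KE ≤ K(N+1)}` plus an exponential `LG` energy tail — provable for ALL
  profiles; and SW becomes SWL, whose equilibrium case is a PURE decorrelation statement (`sameWindowPairCovLongConst_of_decorrelation`).

Registered stubs (rev 5): B1 `stub_singleKickBias` (shared, NECESSARY p150031, open: one-sided chaos in first moment), U `stub_shortFlightLG`
(`LG`-mean short-flight count; open off equilibrium, count class; proved at constant profiles), SWL `stub_sameWindowPairCovLong` (open off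
equilibrium; at constant profiles ⟸ `FarPairDecorrelationLongConst`, `sameWindowPairCovLongConst_of_decorrelation` p163327), CPL
`stub_closePairCountLong` — LANDED (p164751: `…MesoClosePairCountLong`, pathwise part p164215, for ALL continuous positive profiles), glue
`stub_longWindowReduction : B1 → U → SWL → CPL → MesoBody rs` — LANDED (p163816 = `mesoBody_of_long` p163594 ∘ `truncatedFluctuationLong_of_window`
p163373). Rev 5b wires both, so the file's only `sorry`s are the three PHYSICAL stubs {B1, U, SWL}. `KickFairRelEquilibriumMeso_of` concludes the
crux BY NAME. EQUILIBRIUM status: crux_const ⟸ FarPairDecorrelationLongConst ALONE (B1_const p156240, U_const p126384, CPL p164751, glue p163816,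
SWL_const split p163327) — the pair-Campbell count wall of rev 3 is gone.

## Disproof used
`Cruxes/KickFairRelEquilibriumMeso/Disproof.lean` (cdisprove c1; D0–D5): no `_false_without_<H>`, no `-- Targets` for this decl. D1 window algebra
consumed (`kickFairRelEquilibriumMeso_iff`); D2 = necessity of B1 (p150031); D4 met (every stub quantifies over `LG`). Negatives: fixed-mesh
13478/14914 respected (`rs → 0`, κ-relative); necklace 13733: no tail / speed-`N` statement anywhere — U and CPL are MEAN statements (the necklace's
short-flight collisions cost `e^{-cN^{1/3}log N}` in probability and enter only through means); 13479 Bochner junk: `Γ`, `β` are condExps of bounded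
integrands under a probability law.
-/

noncomputable section

open MeasureTheory Set Filter Topology
open scoped ENNReal Classical

namespace Summit.AtomisticToContinuum.HydrodynamicLimit.Cruxes.KickFairRelEquilibriumMeso.KineticWindowCut

open Literature.Analysis.FluidPDE Literature.MathematicalPhysics.KineticTheory
open Summit.AtomisticToContinuum.HydrodynamicLimit.Theorems.KickFairRelEquilibriumMesoLine
  (Past Phase Flow cnt past kick kappa tN rs rs_pos tendsto_rs tendsto_succ_mul_rs_pow_three
    kickDev betaLG pairCondCovLG SingleKickBias IsLong PairCloseL PairFarL ShortFlightLG
    SameWindowPairCovLong ClosePairCountLong TruncatedFluctuationLong)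
open Summit.AtomisticToContinuum.HydrodynamicLimit.Theorems.KickFairRelEquilibriumMesoNegative
  (MesoBody kickFairRelEquilibriumMeso_iff)

/-! ## Registered stubs (`Holds.stub_*`; bodies `sorry` for the three open ones, the landed CPL and glue by name) -/

namespace Holds

/-- **STUB B1 `stub_singleKickBias`** — the NECESSARY core (`SingleKickBias rs`, `…ConditionThePastDefs`):
`E_LG[(ε/(N+1)) Σ|E_LG[g(X) − κ | σ(P)]|] → 0` along `rs N = (N+1)^{-1/4}`. Open (positive-time one-sided chaos in first moment,
Boltzmann-hypothesis class at fixed reduced density); trivial at constant profiles (`betaLG_const_ae_eq_zero`, p156240). -/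
theorem stub_singleKickBias : SingleKickBias rs := by
  sorry

/-- **STUB U `stub_shortFlightLG`** — the normalised number of SHORT-flight collisions (flight of `i` before the kick `< t_N/A`) is small in
`LG`-mean for `A` large (`ShortFlightLG`, verbatim the registered statement of the line `Sketch`). Proved at constant profiles
(`shortFlightLG_rung0`, p126384); `LG`-native off equilibrium (count class; implies CT-a, p148642). -/
theorem stub_shortFlightLG : ShortFlightLG := by
  sorry

/-- **STUB SWL `stub_sameWindowPairCovLong`** — same-window FAR pairs of LONG-flight kicks: the `LG`-conditional covariance of the two centred kicks
given the join of their typed pasts is small on `N^{1/3}`-normalised pair-average (`SameWindowPairCovLong rs`). The line's pair content: collision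
points `≥ 2 rs N` apart within one kinetic window, flights `≥ t_N/A`, `≤ 4` photos, deterministic number of pairs. Open off equilibrium (equal-time
mesoscopic spatial decorrelation under the evolved law); at constant profiles ⟸ `FarPairDecorrelationLongConst` (pure decorrelation). -/
theorem stub_sameWindowPairCovLong : SameWindowPairCovLong rs := by
  sorry

/-- **STUB CPL `stub_closePairCountLong`** — same-window CLOSE pairs of long-flight kicks are few after the `N^{1/3}(ε/(N+1))²` normalisation
(`ClosePairCountLong rs`): deterministic packing count on the energy-typical set plus an exponential `LG` energy tail. LANDED for all continuous
positive profiles (p164751, lead c8). -/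
theorem stub_closePairCountLong : ClosePairCountLong rs :=
  Summit.AtomisticToContinuum.HydrodynamicLimit.Theorems.KickFairRelEquilibriumMesoLine.stub_closePairCountLong

/-- **STUB glue `stub_longWindowReduction`** — `B1 → U → SWL → CPL → MesoBody rs`: the bias/short/long splitting of `S_h` (ReductionA's
bookkeeping with the short part paid by U), Fatou in the index-truncation level (long kicks are pathwise `≤ (A+1)(N+1)W`), and the window cut
`truncatedFluctuationLong_of_window : SWL → CPL → TFL` (WindowCut's per-window PairExpansion2 with validity events cut to long flights). LANDED (p163816). -/
theorem stub_longWindowReduction :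
    SingleKickBias rs → ShortFlightLG → SameWindowPairCovLong rs → ClosePairCountLong rs → MesoBody rs :=
  Summit.AtomisticToContinuum.HydrodynamicLimit.Theorems.KickFairRelEquilibriumMesoLine.stub_longWindowReduction

end Holds

/-! ## Stub statements by name (D-0027 §3.3: the hypotheses of `_of` are these `Prop`s) -/

/-- Statement of the registered stub `Holds.stub_singleKickBias`, by name. -/
def stub_singleKickBias : Prop := type_of% Holds.stub_singleKickBias
/-- Statement of the registered stub `Holds.stub_shortFlightLG`, by name. -/
def stub_shortFlightLG : Prop := type_of% Holds.stub_shortFlightLG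
/-- Statement of the registered stub `Holds.stub_sameWindowPairCovLong`, by name. -/
def stub_sameWindowPairCovLong : Prop := type_of% Holds.stub_sameWindowPairCovLong

/-! ## Composition (sorry-free): the stubs ⟹ the crux BY NAME -/

/-- **The skeleton theorem (rev 5b).** The crux from the three OPEN registered stubs B1, U, SWL: the landed glue (with the landed CPL) turns them into the body of the crux along
`rs N = (N+1)^{-1/4}`; the landed window algebra (`kickFairRelEquilibriumMeso_iff`, p109023) with the landed admissibility of the witness
(`rs_pos`, `tendsto_rs`, `tendsto_succ_mul_rs_pow_three`, p109029) closes the `∃ rs` prefix. -/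
theorem KickFairRelEquilibriumMeso_of (hB1 : stub_singleKickBias) (hU : stub_shortFlightLG) (hSWL : stub_sameWindowPairCovLong) :
    Summit.AtomisticToContinuum.HydrodynamicLimit.Theses.InformationPercolationEngine.KickFairRelEquilibriumMeso :=
  kickFairRelEquilibriumMeso_iff.2
    ⟨rs, rs_pos, tendsto_rs, tendsto_succ_mul_rs_pow_three,
      -- glue LANDED (p163816) applied to the three open stubs and the LANDED CPL (p164751)
      Holds.stub_longWindowReduction hB1 hU hSWL Holds.stub_closePairCountLong⟩

/-- D-0027 §3.3 shape: the crux from the registered stubs — an `example`, so that `KickFairRelEquilibriumMeso_of` stays the unique theorem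
concluding the crux. -/
example :
    Summit.AtomisticToContinuum.HydrodynamicLimit.Theses.InformationPercolationEngine.KickFairRelEquilibriumMeso :=
  KickFairRelEquilibriumMeso_of Holds.stub_singleKickBias Holds.stub_shortFlightLG Holds.stub_sameWindowPairCovLong

end Summit.AtomisticToContinuum.HydrodynamicLimit.Cruxes.KickFairRelEquilibriumMeso.KineticWindowCut

end
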